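import Summits.ResolutionOfSingularities.ResolutionOfSingularities.Theorems.FrobeniusClosingPatchingRelPerfectPointBlowupChartIterate
import Summits.ResolutionOfSingularities.ResolutionOfSingularities.Theorems.FrobeniusClosingPatchingRelPerfectJacobianCriterion
import Literature.AlgebraicGeometry.Resolution.BlowupChartQuotients
import HarnessLib

/-!
# Crux `PatchingRelPerfect` (stmt-ResolutionOfSingularities-16161), chain w52 — CORE RUNG r2pt,
# part 1a: the quadric-cone member on the Rees charts of the point blow-up — chart ideals

[OURS · L1 W5.2 · rung] Rung r2pt of CHAIN.md v1.2 (typed target `TargetR2pt` of plan-1's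
`ChainW52TargetsC.lean`): the blow-up-form open core (`stub_atomDimFourBlowup` /
`CoreBlowupFormAt S I`) for the ideal `I = (x₀³, x₁³, x₂³, x₃³, q)`, `q = x₀x₁ + x₂²`, of a
regular local ring `S` with regular system of parameters `x₀, …, x₃` — the first member of the
`𝔪`-primary family whose initial surface `V(q̄) ⊂ E ≅ ℙ³` is SINGULAR (the quadric cone, vertex
`z₀ = [0:0:0:1]`), so that the "blow up the initial scheme" companion `𝔪` of rungs r1a–r1f does
not work and a TOWER is needed.  `I` is a reduction of `K = (q) + 𝔪³` (r1d), and the companion of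
`K` found here is `Q = 𝔪 · Q₀`, `Q₀ = (P + 𝔪²)(P² + 𝔪³)`, `P = (x₀, x₁, x₂)`: the blowing up of
`Spec S` along `K · Q` is the tower

  `Bl_𝔪 S ← Bl_{z₀} ← Bl_{W₀} ← Bl_{Z''}`

(`z₀` the vertex, `W₀ = E_{z₀} ∩ E^{st}` a plane, `Z''` the strict transform of the cone — every
centre regular in a regular ambient, so Liu 8.1.19 (a) applies at each step).  This file does
LEVEL ONE, on the Rees charts `Spec B_i`, `B_i = (S[𝔪t])_{(x_i t)}`, `u = x_i/1`, `e_j = x_j/x_i`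
(`BlowupChartRsop.lean`), over ANY commutative ring for the identities:

* `chartBase_q` — `φ(q) = u² F` with `F = e₀e₁ + e₂²` on every chart (`e_i = 1`);
* `map_chartBase_K`, `map_chartBase_PM`, `map_chartBase_P2M3`, `map_chartBase_KQ` — the total
  transforms `K B_i = u²(u, F)`, `(P + 𝔪²)B_i = u (u, e₀, e₁, e₂)`,
  `(P² + 𝔪³)B_i = u² ((e₀, e₁, e₂)² + (u))`, and their product;
* `exists_quot_span_u_F_equiv` — `κ[T_j : j ≠ i] ⧸ (F₀) ≅ B_i ⧸ (u, F)` for any polynomial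
  `F₀` lifting `F` modulo `u` (`chartQuotEquiv`), with its value on classes;
  `isRegularRing_quot_span_u_F`, `isRegularLocalRing_localization_quot_span_u_F` — the global and
  the pointwise Jacobian criterion for `B_i ⧸ (u, F)` read through it (tree toolkit
  `…JacobianCriterion.lean`).  The chart-by-chart regularity statements are part 1b
  (`…ConeMemberLevelOne.lean`).

Nothing here is a statement of the manuscript under review.

## References

* Q. Liu, *Algebraic Geometry and Arithmetic Curves*, OUP 2002, Thm. 8.1.19 (a). [Liu2002]
* The Stacks Project, Tags 080A, 0804, 0BIQ. [StacksProject]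
* H. Matsumura, *Commutative Ring Theory*, CUP 1986, Thm. 14.2. [Matsumura1987]
-/

-- `Summit.<Summit>.<Sub>.Theorems` with `Sub = Summit` (single-conjunct summit, D-0017)
set_option linter.dupNamespace false

noncomputable section

open CategoryTheory CategoryTheory.Limits AlgebraicGeometry Literature.AlgebraicGeometry.Resolution
open IsLocalRing

namespace Summit.ResolutionOfSingularities.ResolutionOfSingularities.Theorems

namespace ConeRung

universe u

/-! ## Small ideal algebra -/

/-- `span {a} * span {b, c} = span {a b, a c}`. [folklore] -/
theorem span_singleton_mul_span_pair {A : Type*} [CommSemiring A] (a b c : A) :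
    Ideal.span {a} * Ideal.span {b, c} = Ideal.span {a * b, a * c} := by
  rw [Ideal.span_mul_span', Set.singleton_mul, Set.image_insert_eq, Set.image_singleton]

/-- `span {a} * span {b, c, d} = span {a b, a c, a d}`. [folklore] -/
theorem span_singleton_mul_span_triple {A : Type*} [CommSemiring A] (a b c d : A) :
    Ideal.span {a} * Ideal.span {b, c, d} = Ideal.span {a * b, a * c, a * d} := by
  rw [Ideal.span_mul_span', Set.singleton_mul, Set.image_insert_eq, Set.image_insert_eq,
    Set.image_singleton]

/-- `span {a²b, a³} = span {a}² · span {a, b}`. [folklore] -/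
theorem span_sq_mul_sup_cube {A : Type*} [CommSemiring A] (a b : A) :
    Ideal.span {a ^ 2 * b} ⊔ Ideal.span {a} ^ 3 = Ideal.span {a} ^ 2 * Ideal.span {a, b} := by
  rw [Ideal.span_singleton_pow, Ideal.span_singleton_pow, span_singleton_mul_span_pair,
    ← pow_succ, Ideal.span_insert, sup_comm]

/-! ## Level one: the ideals `K`, `P + 𝔪²`, `P² + 𝔪³` on the Rees charts of `Bl_𝔪` -/

section AnyRing

variable {S : Type u} [CommRing S] (x : Fin 4 → S) (i : Fin 4)

local notation3 "M" => Ideal.span (Set.range x)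
local notation3 "KK" => Ideal.span {x 0 * x 1 + x 2 ^ 2} ⊔ Ideal.span (Set.range x) ^ 3
local notation3 "PP" => Ideal.span {x 0, x 1, x 2}
local notation3 "B" => chartRing x i
local notation3 "φ" => chartBase x i
local notation3 "u" => chartBase x i (x i)
local notation3 "e[" j "]" => chartGen x i j
local notation3 "F" => chartGen x i 0 * chartGen x i 1 + chartGen x i 2 ^ 2

/-- `𝔪 B_i = (u)`. [cite: StacksProject, Tag 0804] -/
theorem map_chartBase_M : (M).map φ = Ideal.span {u} :=
  map_reesChartBase_eq (x i) (Ideal.mem_span_range_self (f := x) (x := i))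

/-- **`φ(q) = u² F`**, `F = e₀e₁ + e₂²`, on every chart. [folklore] -/
theorem chartBase_q : φ (x 0 * x 1 + x 2 ^ 2) = u ^ 2 * F := by
  rw [map_add, map_mul, map_pow, reesChartBase_apply_eq_mul_chartGen x i 0,
    reesChartBase_apply_eq_mul_chartGen x i 1, reesChartBase_apply_eq_mul_chartGen x i 2]
  ring

/-- **`K B_i = u² (u, F)`**. [folklore] -/
theorem map_chartBase_K : (KK).map φ = Ideal.span {u} ^ 2 * Ideal.span {u, F} := by
  rw [Ideal.map_sup, Ideal.map_pow, map_chartBase_M, Ideal.map_span, Set.image_singleton,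
    chartBase_q, span_sq_mul_sup_cube]

/-- `P B_i = u · (e₀, e₁, e₂)`. [folklore] -/
theorem map_chartBase_P : (PP).map φ = Ideal.span {u} * Ideal.span {e[0], e[1], e[2]} := by
  rw [Ideal.map_span, Set.image_insert_eq, Set.image_insert_eq, Set.image_singleton,
    reesChartBase_apply_eq_mul_chartGen x i 0, reesChartBase_apply_eq_mul_chartGen x i 1,
    reesChartBase_apply_eq_mul_chartGen x i 2, span_singleton_mul_span_triple]

/-- **`(P + 𝔪²) B_i = u · (u, e₀, e₁, e₂)`**. [folklore] -/
theorem map_chartBase_PM :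
    (PP ⊔ M ^ 2).map φ = Ideal.span {u} * Ideal.span {u, e[0], e[1], e[2]} := by
  rw [Ideal.map_sup, Ideal.map_pow, map_chartBase_M, map_chartBase_P,
    Ideal.span_insert u, Ideal.mul_sup, pow_two, sup_comm]

/-- **`(P² + 𝔪³) B_i = u² · ((e₀, e₁, e₂)² + (u))`**. [folklore] -/
theorem map_chartBase_P2M3 :
    (PP ^ 2 ⊔ M ^ 3).map φ =
      Ideal.span {u} ^ 2 * (Ideal.span {e[0], e[1], e[2]} ^ 2 ⊔ Ideal.span {u}) := by
  rw [Ideal.map_sup, Ideal.map_pow, Ideal.map_pow, map_chartBase_M, map_chartBase_P, mul_pow,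
    Ideal.mul_sup, ← pow_succ]

/-- **The total transform of `K · Q₀`, `Q₀ = (P + 𝔪²)(P² + 𝔪³)`, on every chart:**
`(K Q₀) B_i = u⁵ · (u, F) · (u, e₀, e₁, e₂) · ((e₀, e₁, e₂)² + (u))`. [folklore] -/
theorem map_chartBase_KQ :
    (KK * ((PP ⊔ M ^ 2) * (PP ^ 2 ⊔ M ^ 3))).map φ =
      Ideal.span {u ^ 5} * (Ideal.span {u, F} *
        (Ideal.span {u, e[0], e[1], e[2]} *
          (Ideal.span {e[0], e[1], e[2]} ^ 2 ⊔ Ideal.span {u}))) := by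
  rw [Ideal.map_mul, Ideal.map_mul, map_chartBase_K, map_chartBase_PM, map_chartBase_P2M3,
    ← Ideal.span_singleton_pow]
  ring

end AnyRing


/-! ## Transport of pointwise regularity along a ring isomorphism -/

/-- Regularity at a prime transports along a ring isomorphism. [folklore] -/
theorem isRegularLocalRing_localization_of_ringEquiv {A₁ A₂ : Type*} [CommRing A₁] [CommRing A₂]
    (e : A₁ ≃+* A₂) (P : Ideal A₂) [P.IsPrime]
    [h : IsRegularLocalRing (Localization.AtPrime (P.comap e))] :
    IsRegularLocalRing (Localization.AtPrime P) :=
  IsRegularLocalRing.of_ringEquiv (IsLocalization.ringEquivOfRingEquiv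
    (Localization.AtPrime (P.comap e)) (Localization.AtPrime P) e (e.map_primeCompl_comap_eq P))

/-! ## The quotient `B_i ⧸ (u, F)` as a polynomial hypersurface ring -/

section Quot

variable {S : Type u} [CommRing S] (x : Fin 4 → S) (i : Fin 4) (hqr : IsQuasiRegular x)

local notation3 "M" => Ideal.span (Set.range x)
local notation3 "B" => chartRing x i
local notation3 "φ" => chartBase x i
local notation3 "u" => chartBase x i (x i)
local notation3 "e[" j "]" => chartGen x i j
local notation3 "F" => chartGen x i 0 * chartGen x i 1 + chartGen x i 2 ^ 2
local notation3 "Pol" => MvPolynomial {j : Fin 4 // j ≠ i} (S ⧸ Ideal.span (Set.range x))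
local notation3 "ε" => chartQuotEquiv x i hqr

/-- `(u, F) = (u) + (F)`. [folklore] -/
theorem span_u_F_eq_sup : Ideal.span {u, F} = Ideal.span {u} ⊔ Ideal.span {F} :=
  Ideal.span_insert _ _

set_option maxHeartbeats 400000 in
/-- **`κ[T_j : j ≠ i] ⧸ (F₀) ≅ B_i ⧸ (u, F)`** for every polynomial `F₀` lifting `F` modulo `u`
(`chartQuotEquiv` then the third isomorphism theorem), together with its value on classes:
the class of `p` goes to the class of any `b` with `ε(p) = b̄`. [cite: StacksProject, Tag 0BIQ] -/
theorem exists_quot_span_u_F_equiv (F₀ : Pol)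
    (hF₀ : ε F₀ = Ideal.Quotient.mk (Ideal.span {u}) F) :
    ∃ eq : (Pol ⧸ Ideal.span {F₀}) ≃+* (B ⧸ Ideal.span {u, F}),
      ∀ (p : Pol) (b : B), ε p = Ideal.Quotient.mk (Ideal.span {u}) b →
        eq (Ideal.Quotient.mk _ p) = Ideal.Quotient.mk _ b := by
  have h1 : (Ideal.span {F}).map (Ideal.Quotient.mk (Ideal.span {u})) =
      (Ideal.span {F₀}).map (ε : Pol →+* B ⧸ Ideal.span {u}) := by
    rw [Ideal.map_span, Set.image_singleton, Ideal.map_span, Set.image_singleton, RingHom.coe_coe,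
      hF₀]
  let e1 : (Pol ⧸ Ideal.span {F₀}) ≃+*
      (B ⧸ Ideal.span {u}) ⧸ (Ideal.span {F}).map (Ideal.Quotient.mk (Ideal.span {u})) :=
    Ideal.quotientEquiv _ _ (ε) h1
  let e2 := DoubleQuot.quotQuotEquivQuotSup (Ideal.span {u}) (Ideal.span {F})
  let e3 : B ⧸ (Ideal.span {u} ⊔ Ideal.span {F}) ≃+* B ⧸ Ideal.span {u, F} :=
    Ideal.quotEquivOfEq (span_u_F_eq_sup x i).symm
  refine ⟨e1.trans (e2.trans e3), fun p b hpb => ?_⟩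
  rw [RingEquiv.trans_apply, RingEquiv.trans_apply]
  have he1 : e1 (Ideal.Quotient.mk _ p) =
      DoubleQuot.quotQuotMk (Ideal.span {u}) (Ideal.span {F}) b := by
    rw [Ideal.quotientEquiv_mk]
    exact congrArg (Ideal.Quotient.mk
      ((Ideal.span {F}).map (Ideal.Quotient.mk (Ideal.span {u})))) hpb
  rw [he1, DoubleQuot.quotQuotEquivQuotSup_quotQuotMk, Ideal.quotEquivOfEq_mk]

/-- **`B_i ⧸ (u, F)` is a regular ring** as soon as the lifted polynomial `F₀` satisfies the
Jacobian criterion everywhere (and the polynomial ring is regular).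
[cite: Matsumura1987, Thm. 14.2] -/
theorem isRegularRing_quot_span_u_F [IsRegularRing Pol] (F₀ : Pol)
    (hF₀ : ε F₀ = Ideal.Quotient.mk (Ideal.span {u}) F)
    (hJ : ∀ (Q : Ideal Pol), Q.IsPrime → F₀ ∈ Q → ∃ j, MvPolynomial.pderiv j F₀ ∉ Q) :
    IsRegularRing (B ⧸ Ideal.span {u, F}) := by
  obtain ⟨eq, -⟩ := exists_quot_span_u_F_equiv x i hqr F₀ hF₀
  haveI := MvPolynomial.isRegularRing_quotient_span_of_pderiv hJ
  exact IsRegularRing.of_ringEquiv (R := Pol ⧸ Ideal.span {F₀}) eq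

/-- **`B_i ⧸ (u, F)` is regular at a prime `P̄`** not containing the class of some lift `b` of a
partial derivative `∂F₀/∂T_j` (Jacobian criterion, pointwise). [cite: Matsumura1987, Thm. 14.2] -/
theorem isRegularLocalRing_localization_quot_span_u_F [IsRegularRing Pol] (F₀ : Pol)
    (hF₀ : ε F₀ = Ideal.Quotient.mk (Ideal.span {u}) F)
    (Pbar : Ideal (B ⧸ Ideal.span {u, F})) [Pbar.IsPrime] (j : {j : Fin 4 // j ≠ i}) (b : B)
    (hb : ε (MvPolynomial.pderiv j F₀) = Ideal.Quotient.mk (Ideal.span {u}) b)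
    (hbP : Ideal.Quotient.mk (Ideal.span {u, F}) b ∉ Pbar) :
    IsRegularLocalRing (Localization.AtPrime Pbar) := by
  obtain ⟨eq, heq⟩ := exists_quot_span_u_F_equiv x i hqr F₀ hF₀
  set P' : Ideal (Pol ⧸ Ideal.span {F₀}) := Pbar.comap eq with hP'
  have hj : Ideal.Quotient.mk (Ideal.span {F₀}) (MvPolynomial.pderiv j F₀) ∉ P' := by
    intro h
    rw [hP', Ideal.mem_comap] at h
    change eq _ ∈ Pbar at h
    rw [heq _ b hb] at h
    exact hbP h
  haveI := MvPolynomial.isRegularLocalRing_atPrime_quotient_of_pderiv_notMem P' j hj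
  exact isRegularLocalRing_localization_of_ringEquiv (A₁ := Pol ⧸ Ideal.span {F₀}) eq Pbar

end Quot

end ConeRung

end Summit.ResolutionOfSingularities.ResolutionOfSingularities.Theorems

end
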